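import Summits.CriticalPhenomena.PercolationContinuityZ3.Theorems.Transplant.FKThreeApexOmegaBig
import Summits.CriticalPhenomena.PercolationContinuityZ3.Theorems.Transplant.FKThreeApexOmegaBigCertA
import Summits.CriticalPhenomena.PercolationContinuityZ3.Theorems.Transplant.FKThreeApexOmegaBigCertB
import Summits.CriticalPhenomena.PercolationContinuityZ3.Theorems.Transplant.FKThreeApexOmegaBigCertC
import Summits.CriticalPhenomena.PercolationContinuityZ3.Theorems.Transplant.FKThreeApexOmegaBigCertD
import Summits.CriticalPhenomena.PercolationContinuityZ3.Theorems.Transplant.FKThreeApexOmegaBigCertE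
import Summits.CriticalPhenomena.PercolationContinuityZ3.Theorems.Transplant.FKThreeApexOmegaBigCertF
import Summits.CriticalPhenomena.PercolationContinuityZ3.Theorems.Transplant.FKThreeApexOmegaBigCertG
import HarnessLib

/-!
# The three-apex monoid: the polynomial `BIG` of the semigroup theorem for `Ω_q` — assembly `BIG = Σ blocks ≥ 0`

Helper file (`--supports stmt-CriticalPhenomena-4575`), FK sub-lane `prim-bschramm-fk-3` (gen 14); builds on p205010 (kernel theorem, internal audit
signed; external expert review pending).  Pure real algebra, machine-generated from the exact certificate
`bschramm/prim-bschramm-fk-3/code-g14/certs/BIG_cert_lowdeg_j143315.json` (LP on kit j143315, solved exactly, re-verified in exact arithmetic);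
no sorries; standard axioms.  Memo `bschramm/prim-bschramm-fk-3/DISJOINT-VIA-U.md` §2 (F1).  For two points `C(s,t)`, `C(s₂,t₂)` of the curved
boundary of `Ω_q` (`A = (2−q)(t²+2t+s)/D`, `B = (2−q)(st²+2t+1)/D`, `D = s((2−q)t²+2(1−q)t+(2−q)) + 2t`) the `(U_a)`-determinant
`4N^{(ab)}N^{(ac)} − (2−q)²J_a²` of their coordinatewise product equals `(1−s)(1−s₂)·BIG(q,s,s₂,t,t₂)` (`Big.boundary_prod_det`), and
`BIG = Σ_k c_k · q^a(1−q)^b s^c(1−s)^d s₂^e(1−s₂)^f t^i t₂^j·[1 | (t−t₂)²]` with `1092` positive rationals `c_k` (blocks `bigPart0 … bigPart10`, files `…BigCertA`–`G`),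
hence **`Big.bigPoly_nonneg`**: `BIG ≥ 0` for `q,s,s₂ ∈ [0,1]`, `t,t₂ ≥ 0` — the algebraic core of "`Ω_q` is closed under multiplication".
This file: `bigPoly_eq_sum` (`ring`) and **`bigPoly_nonneg`**.
[folklore]
-/

noncomputable section

namespace Summit.CriticalPhenomena.PercolationContinuityZ3.Theorems

namespace FK

namespace ThreeApex

namespace Big

set_option maxHeartbeats 8000000 in
set_option maxRecDepth 200000 in
/-- `BIG` is the sum of the certificate blocks. [folklore] -/
theorem bigPoly_eq_sum (q s s₂ t t₂ : ℝ) : bigPoly q s s₂ t t₂ = bigSumA q s s₂ t t₂ + bigSumB q s s₂ t t₂ + bigSumC q s s₂ t t₂ + bigSumD q s s₂ t t₂ + bigSumE q s s₂ t t₂ + bigSumF q s s₂ t t₂ + bigSumG q s s₂ t t₂ := by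
  unfold bigPoly bigSumA bigSumB bigSumC bigSumD bigSumE bigSumF bigSumG bigPart2 bigPart3
  ring

/-- **`BIG ≥ 0`** for `q ∈ [0,1]`, `s, s₂ ∈ [0,1]`, `t, t₂ ≥ 0`. [folklore] -/
theorem bigPoly_nonneg {q s s₂ t t₂ : ℝ} (hq0 : 0 ≤ q) (hq1 : q ≤ 1) (hs0 : 0 ≤ s) (hs1 : s ≤ 1) (hr0 : 0 ≤ s₂) (hr1 : s₂ ≤ 1)
    (ht : 0 ≤ t) (ht₂ : 0 ≤ t₂) : 0 ≤ bigPoly q s s₂ t t₂ := by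
  have e := bigPoly_eq_sum q s s₂ t t₂
  have hA := bigSumA_nonneg (q := q) (s := s) (s₂ := s₂) (t := t) (t₂ := t₂) hq0 hq1 hs0 hs1 hr0 hr1 ht ht₂
  have hB := bigSumB_nonneg (q := q) (s := s) (s₂ := s₂) (t := t) (t₂ := t₂) hq0 hq1 hs0 hs1 hr0 hr1 ht ht₂
  have hC := bigSumC_nonneg (q := q) (s := s) (s₂ := s₂) (t := t) (t₂ := t₂) hq0 hq1 hs0 hs1 hr0 hr1 ht ht₂
  have hD := bigSumD_nonneg (q := q) (s := s) (s₂ := s₂) (t := t) (t₂ := t₂) hq0 hq1 hs0 hs1 hr0 hr1 ht ht₂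
  have hE := bigSumE_nonneg (q := q) (s := s) (s₂ := s₂) (t := t) (t₂ := t₂) hq0 hq1 hs0 hs1 hr0 hr1 ht ht₂
  have hF := bigSumF_nonneg (q := q) (s := s) (s₂ := s₂) (t := t) (t₂ := t₂) hq0 hq1 hs0 hs1 hr0 hr1 ht ht₂
  have hG := bigSumG_nonneg (q := q) (s := s) (s₂ := s₂) (t := t) (t₂ := t₂) hq0 hq1 hs0 hs1 hr0 hr1 ht ht₂
  linarith

end Big

end ThreeApex

end FK

end Summit.CriticalPhenomena.PercolationContinuityZ3.Theorems
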